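import Summits.Ventures.QEC.Census.FoldDefs3
import Summits.Ventures.QEC.Census.FoldDriver
import HarnessLib

/-!
# Fold enumeration — soundness of the table-assisted scan (`FoldDefs3`)

Completeness of `scanPT` from the CHECKED table facts (`tabOK1`, `tabOK2`), then the twins of
`mem_fiber_of_solution`, `Geo.fiber_complete`, `Geo.goodFib_of_all`, `nodeCheck_sound`, `nodeCheck_of_nodeCheckMod`
for `fiberPT` / `nodeCheckPT` / `nodeCheckModPT` (same statements, same proofs up to the enumerator).
-/

namespace Summit.Ventures.QEC.Census.Fold

open Summit.Ventures.QEC.Census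

/-! ## List helpers -/
/-- the tail of a `drop` is the next `drop`. -/
theorem drop_succ_of_cons {α : Type} {L : List α} : ∀ {i : ℕ} {a : α} {L' : List α}, a :: L' = L.drop i → L' = L.drop (i + 1) := by
  induction L with
  | nil => intro i a L' h; simp at h
  | cons x M ih =>
    intro i a L' h
    cases i with
    | zero => simp only [List.drop_zero, List.cons.injEq] at h; rw [h.2, List.drop_one, List.tail_cons]
    | succ k => rw [List.drop_succ_cons] at h ⊢; exact ih h
/-- membership in a `drop` by index. -/
theorem mem_drop_iff_idx {α : Type} {L : List α} {i : ℕ} {a : α} : a ∈ L.drop i → ∃ j, i ≤ j ∧ L[j]? = some a := by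
  intro h
  obtain ⟨k, hk, rfl⟩ := List.getElem_of_mem h
  exact ⟨i + k, Nat.le_add_right _ _, by rw [← List.getElem?_drop]; exact List.getElem?_eq_getElem hk⟩
/-- a two-element sublist sits at two increasing indices. -/
theorem pair_sublist_idx {α : Type} {a c : α} : ∀ {M : List α}, [a, c].Sublist M → ∃ k1 k2 : ℕ, k1 < k2 ∧ M[k1]? = some a ∧ M[k2]? = some c := by
  intro M h
  induction M with
  | nil => simp at h
  | cons x M ih =>
    cases h with
    | cons _ h' =>
      obtain ⟨k1, k2, hlt, h1, h2⟩ := ih h'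
      exact ⟨k1 + 1, k2 + 1, by omega, by simpa using h1, by simpa using h2⟩
    | cons_cons _ h' =>
      obtain ⟨k, hk, rfl⟩ := List.getElem_of_mem (h'.subset (List.mem_singleton_self c))
      exact ⟨0, k + 1, by omega, rfl, by simp [List.getElem?_eq_getElem hk]⟩

/-! ## The checked table facts -/
/-- `tabOK1` establishes the index/singles facts from position `i` on. -/
theorem tabOK1_sound (T : NodeTab) (r b : ℕ) : ∀ (L : List (ℕ × ℕ × ℕ)) (i : ℕ), tabOK1 T r b L i = true →
    ∀ j oc, L[j]? = some oc → tab T.OI 8 (i + j) = oc.1 ∧ tab T.MI r (i + j) = oc.2.1 ∧ tab T.RI r (i + j) = oc.2.2 ∧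
      (i + j + 1) ∈ codes8 (tab T.S1 slotW (slotOf b oc.2.2)) := by
  intro L
  induction L with
  | nil => intro i _ j oc h; simp at h
  | cons x L ih =>
    intro i h j oc hj
    simp only [tabOK1, Bool.and_eq_true, beq_iff_eq, List.elem_eq_mem, decide_eq_true_eq] at h
    cases j with
    | zero =>
      simp only [List.getElem?_cons_zero, Option.some.injEq] at hj; subst hj
      simpa using ⟨h.1.1.1.1, h.1.1.1.2, h.1.1.2, h.1.2⟩
    | succ j =>
      have := ih (i + 1) h.2 j oc (by simpa using hj)
      simpa [Nat.add_assoc, Nat.add_comm 1 j, Nat.add_left_comm] using this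
/-- `pairsRowOK` establishes the pair facts of one row. -/
theorem pairsRowOK_sound (T : NodeTab) (b ri i : ℕ) : ∀ (L : List (ℕ × ℕ × ℕ)) (j0 : ℕ), pairsRowOK T b ri i L j0 = true →
    ∀ j oc, L[j]? = some oc → ((i + 1) + 256 * (j0 + j + 1)) ∈ codes16 (tab T.S2 slotW (slotOf b (ri ^^^ oc.2.2))) := by
  intro L
  induction L with
  | nil => intro j0 _ j oc h; simp at h
  | cons x L ih =>
    intro j0 h j oc hj
    simp only [pairsRowOK, Bool.and_eq_true, List.elem_eq_mem, decide_eq_true_eq] at h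
    cases j with
    | zero =>
      simp only [List.getElem?_cons_zero, Option.some.injEq] at hj; subst hj
      simpa using h.1
    | succ j =>
      have := ih (j0 + 1) h.2 j oc (by simpa using hj)
      simpa [Nat.add_assoc, Nat.add_comm 1 j, Nat.add_left_comm] using this
/-- `tabOK2` establishes the pair facts from position `i` on. -/
theorem tabOK2_sound (T : NodeTab) (b : ℕ) : ∀ (L : List (ℕ × ℕ × ℕ)) (i : ℕ), tabOK2 T b L i = true →
    ∀ j1 j2 a c, j1 < j2 → L[j1]? = some a → L[j2]? = some c →
      ((i + j1 + 1) + 256 * (i + j2 + 1)) ∈ codes16 (tab T.S2 slotW (slotOf b (a.2.2 ^^^ c.2.2))) := by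
  intro L
  induction L with
  | nil => intro i _ j1 j2 a c _ h; simp at h
  | cons x L ih =>
    intro i h j1 j2 a c hlt h1 h2
    simp only [tabOK2, Bool.and_eq_true] at h
    cases j1 with
    | zero =>
      simp only [List.getElem?_cons_zero, Option.some.injEq] at h1; subst h1
      cases j2 with
      | zero => omega
      | succ j2 =>
        have := pairsRowOK_sound T b x.2.2 i L (i + 1) h.1 j2 c (by simpa using h2)
        simpa [Nat.add_assoc, Nat.add_comm, Nat.add_left_comm] using this
    | succ j1 =>
      cases j2 with
      | zero => omega
      | succ j2 =>
        have := ih (i + 1) h.2 j1 j2 a c (by omega) (by simpa using h1) (by simpa using h2)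
        simpa [Nat.add_assoc, Nat.add_comm 1, Nat.add_left_comm] using this
/-- decoded codes are `w`-bit. -/
theorem lt_of_mem_decodes (w : ℕ) : ∀ (f v c : ℕ), c ∈ decodes w f v → c < 2 ^ w := by
  intro f
  induction f with
  | zero => intro v c h; simp [decodes] at h
  | succ f ih =>
    intro v c h
    unfold decodes at h
    split at h
    · simp at h
    · rcases List.mem_cons.1 h with rfl | h
      · exact Nat.mod_lt _ (Nat.two_pow_pos _)
      · exact ih _ _ h
/-- `lt_of_mem_codes16`: 16-bit codes (auxiliary lemma of the fold-certificate soundness chain). -/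
theorem lt_of_mem_codes16 {v c : ℕ} (h : c ∈ codes16 v) : c < 2 ^ 16 := lt_of_mem_decodes 16 _ _ _ h

/-! ## Completeness of the lookups -/
/-- The checked index/singles facts of a node. -/
def IdxFacts (T : NodeTab) (r b : ℕ) (Ot : List (ℕ × ℕ × ℕ)) : Prop :=
  ∀ j oc, Ot[j]? = some oc → tab T.OI 8 j = oc.1 ∧ tab T.MI r j = oc.2.1 ∧ tab T.RI r j = oc.2.2 ∧
    (j + 1) ∈ codes8 (tab T.S1 slotW (slotOf b oc.2.2))
/-- The checked pair facts of a node. -/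
def PairFacts (T : NodeTab) (b : ℕ) (Ot : List (ℕ × ℕ × ℕ)) : Prop :=
  ∀ j1 j2 a c, j1 < j2 → Ot[j1]? = some a → Ot[j2]? = some c →
    ((j1 + 1) + 256 * (j2 + 1)) ∈ codes16 (tab T.S2 slotW (slotOf b (a.2.2 ^^^ c.2.2)))

section Look
/-- a leaf records the listed solutions. -/
theorem mem_leafPT (Pv : Piv) (MP : List ℕ) {v : ℕ} {e : List ℕ} {x : ℕ} (hx : x ∈ Pv.solutions MP v) :
    (e, x) ∈ leafPT Pv MP v 0 e := by
  simp only [leafPT, beq_self_eq_true, if_true, List.mem_map]; exact ⟨x, hx, rfl⟩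

variable (Pv : Piv) (MP : List ℕ) (T : NodeTab) (r b : ℕ) (Ot : List (ℕ × ℕ × ℕ))
/-- singles lookup finds every later column with the wanted reduction. -/
theorem mem_look1 (HT1 : IdxFacts T r b Ot) {i j : ℕ} {oc : ℕ × ℕ × ℕ} (hj : Ot[j]? = some oc) (hij : i ≤ j) {v : ℕ} {e : List ℕ} {x : ℕ}
    (hx : x ∈ Pv.solutions MP (v ^^^ oc.2.1)) : (oc.1 :: e, x) ∈ look1 Pv MP T r b v oc.2.2 e i := by
  obtain ⟨hO, hM, hR, hc⟩ := HT1 j oc hj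
  unfold look1
  rw [List.mem_flatMap]
  refine ⟨j + 1, hc, ?_⟩
  have h1 : ((j + 1 == 0) || !(i + 1 ≤ j + 1) || !(tab T.RI r (j + 1 - 1) == oc.2.2)) = false := by
    simp [hR, hij]
  rw [h1]
  simp only [Bool.false_eq_true, if_false, List.mem_map, Nat.add_sub_cancel]
  exact ⟨x, by rw [hM]; exact hx, by rw [hO]⟩
/-- pairs lookup finds every later pair with the wanted reduction. -/
theorem mem_look2 (HT1 : IdxFacts T r b Ot) (HT2 : PairFacts T b Ot) {i j1 j2 : ℕ} {a c : ℕ × ℕ × ℕ} (h1 : Ot[j1]? = some a)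
    (h2 : Ot[j2]? = some c) (hlt : j1 < j2) (hij : i ≤ j1) {v : ℕ} {e : List ℕ} {x : ℕ}
    (hx : x ∈ Pv.solutions MP (v ^^^ a.2.1 ^^^ c.2.1)) :
    (c.1 :: a.1 :: e, x) ∈ look2 Pv MP T r b v (a.2.2 ^^^ c.2.2) e i := by
  obtain ⟨hOa, hMa, hRa, -⟩ := HT1 j1 a h1
  obtain ⟨hOc, hMc, hRc, -⟩ := HT1 j2 c h2
  have hcode := HT2 j1 j2 a c hlt h1 h2
  have hlt16 := lt_of_mem_codes16 hcode
  have hj1 : (j1 + 1 + 256 * (j2 + 1)) % 256 = j1 + 1 := by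
    rw [Nat.add_mul_mod_self_left]; exact Nat.mod_eq_of_lt (by omega)
  have hj2 : (j1 + 1 + 256 * (j2 + 1)) / 256 = j2 + 1 := by
    rw [Nat.add_mul_div_left _ _ (by decide), Nat.div_eq_of_lt (by omega), Nat.zero_add]
  unfold look2
  rw [List.mem_flatMap]
  refine ⟨j1 + 1 + 256 * (j2 + 1), hcode, ?_⟩
  simp only [hj1, hj2, Nat.add_sub_cancel]
  have hc : ((j1 + 1 == 0) || (j2 + 1 == 0) || !(i ≤ j1) || !(tab T.RI r j1 ^^^ tab T.RI r j2 == a.2.2 ^^^ c.2.2)) = false := by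
    simp [hRa, hRc, hij]
  rw [hc]
  simp only [Bool.false_eq_true, if_false, List.mem_map]
  exact ⟨x, by rw [hMa, hMc]; exact hx, by rw [hOa, hOc]⟩
/-- one chosen column `a` from position `i` on: served by `look1`. -/
theorem mem_look1_of_sublist (HT1 : IdxFacts T r b Ot) {L : List (ℕ × ℕ × ℕ)} {i : ℕ} (hL : L = Ot.drop i) {a : ℕ × ℕ × ℕ}
    (ha : [a].Sublist L) {v rv : ℕ} (hrv : rv ^^^ xorIdx (fun oc => oc.2.2) [a] = 0) {e : List ℕ} {x : ℕ}
    (hx : x ∈ Pv.solutions MP (v ^^^ xorIdx (fun oc => oc.2.1) [a])) :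
    (([a].map Prod.fst).reverse ++ e, x) ∈ look1 Pv MP T r b v rv e i := by
  simp only [xorIdx_cons, xorIdx_nil, Nat.xor_zero] at hx hrv
  have ha' : a ∈ Ot.drop i := hL ▸ ha.subset (List.mem_singleton_self a)
  obtain ⟨j, hij, hj⟩ := mem_drop_iff_idx ha'
  have hrv' : rv = a.2.2 := by
    have := congrArg (· ^^^ a.2.2) hrv; simpa [Nat.xor_assoc] using this
  subst hrv'
  simpa using mem_look1 Pv MP T r b Ot HT1 hj hij hx
/-- two chosen columns from position `i` on: served by `look2`. -/
theorem mem_look2_of_sublist (HT1 : IdxFacts T r b Ot) (HT2 : PairFacts T b Ot) {L : List (ℕ × ℕ × ℕ)} {i : ℕ} (hL : L = Ot.drop i)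
    {a c : ℕ × ℕ × ℕ} (hac : [a, c].Sublist L) {v rv : ℕ} (hrv : rv ^^^ xorIdx (fun oc => oc.2.2) [a, c] = 0)
    {e : List ℕ} {x : ℕ} (hx : x ∈ Pv.solutions MP (v ^^^ xorIdx (fun oc => oc.2.1) [a, c])) :
    (([a, c].map Prod.fst).reverse ++ e, x) ∈ look2 Pv MP T r b v rv e i := by
  simp only [xorIdx_cons, xorIdx_nil, Nat.xor_zero] at hx hrv
  obtain ⟨k1, k2, hlt, h1, h2⟩ := pair_sublist_idx (hL ▸ hac)
  rw [List.getElem?_drop] at h1 h2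
  have hrv' : rv = a.2.2 ^^^ c.2.2 := by
    have := congrArg (· ^^^ (a.2.2 ^^^ c.2.2)) hrv
    simpa [Nat.xor_assoc] using this
  subst hrv'
  have hx' : x ∈ Pv.solutions MP (v ^^^ a.2.1 ^^^ c.2.1) := by rwa [← Nat.xor_assoc] at hx
  simpa using mem_look2 Pv MP T r b Ot HT1 HT2 h1 h2 (by omega) (Nat.le_add_right _ _) hx'
/-- the empty choice: served by the leaf. -/
theorem mem_leaf_of_nil {v rv : ℕ} (hrv : rv ^^^ xorIdx (fun oc : ℕ × ℕ × ℕ => oc.2.2) [] = 0) {e : List ℕ} {x : ℕ}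
    (hx : x ∈ Pv.solutions MP (v ^^^ xorIdx (fun oc : ℕ × ℕ × ℕ => oc.2.1) [])) :
    ((([] : List (ℕ × ℕ × ℕ)).map Prod.fst).reverse ++ e, x) ∈ leafPT Pv MP v rv e := by
  simp only [xorIdx_nil, Nat.xor_zero] at hx hrv; subst hrv
  simpa using mem_leafPT Pv MP (e := e) hx
/-- **COMPLETENESS OF THE TABLE-ASSISTED SCAN** (cf. `scan_complete`); the pair facts are only needed
when the pairs table is used (`pr`). -/
theorem scanPT_complete (HT1 : IdxFacts T r b Ot) (pr : Bool) (hP : pr = true → PairFacts T b Ot) :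
    ∀ (L : List (ℕ × ℕ × ℕ)) (s v rv : ℕ) (e : List ℕ) (i : ℕ), L = Ot.drop i →
    ∀ (e' : List (ℕ × ℕ × ℕ)), e'.Sublist L → e'.length ≤ s → rv ^^^ xorIdx (fun oc => oc.2.2) e' = 0 →
      ∀ x ∈ Pv.solutions MP (v ^^^ xorIdx (fun oc => oc.2.1) e'),
        ((e'.map Prod.fst).reverse ++ e, x) ∈ scanPT Pv MP T r b pr L s v rv e i := by
  intro L
  induction L with
  | nil =>
    intro s v rv e i _ e' he' _ hrv x hx
    rw [List.sublist_nil] at he'; subst he'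
    have hl := mem_leaf_of_nil Pv MP hrv (e := e) hx
    match s with
    | 0 => simpa [scanPT] using hl
    | 1 => simp only [scanPT]; exact List.mem_append_left _ hl
    | _ + 2 => simpa [scanPT] using hl
  | cons oc L ih =>
    intro s v rv e i hL e' he' hlen hrv x hx
    have hL' : L = Ot.drop (i + 1) := drop_succ_of_cons hL
    -- the include/skip step (used at budget ≥ 3, and at budget 2 without the pairs table)
    have step : ∀ s', e'.length ≤ s' + 1 →
        ((e'.map Prod.fst).reverse ++ e, x) ∈
          scanPT Pv MP T r b pr L s' (v ^^^ oc.2.1) (rv ^^^ oc.2.2) (oc.1 :: e) (i + 1) ++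
            scanPT Pv MP T r b pr L (s' + 1) v rv e (i + 1) := by
      intro s' hlen'
      cases he' with
      | cons _ he'' =>
        exact List.mem_append_right _ (ih (s' + 1) v rv e (i + 1) hL' _ he'' hlen' hrv x hx)
      | cons_cons _ he'' =>
        rename_i e''
        have hx' : x ∈ Pv.solutions MP ((v ^^^ oc.2.1) ^^^ xorIdx (fun oc => oc.2.1) e'') := by
          rw [xorIdx_cons, ← Nat.xor_assoc] at hx; exact hx
        have hrv' : (rv ^^^ oc.2.2) ^^^ xorIdx (fun oc => oc.2.2) e'' = 0 := by
          rw [xorIdx_cons, ← Nat.xor_assoc] at hrv; exact hrv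
        have := ih s' (v ^^^ oc.2.1) (rv ^^^ oc.2.2) (oc.1 :: e) (i + 1) hL' e'' he''
          (by simp at hlen'; omega) hrv' x hx'
        refine List.mem_append_left _ ?_
        simpa [List.reverse_cons, List.append_assoc] using this
    match s, e', he', hlen, hrv, hx, step with
    | 0, e', he', hlen, hrv, hx, _ =>
      have he0 : e' = [] := List.eq_nil_of_length_eq_zero (Nat.le_zero.1 hlen)
      subst he0
      simpa [scanPT] using mem_leaf_of_nil Pv MP hrv (e := e) hx
    | 1, [], _, _, hrv, hx, _ => simp only [scanPT]; exact List.mem_append_left _ (mem_leaf_of_nil Pv MP hrv hx)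
    | 1, [a], he', _, hrv, hx, _ =>
      simp only [scanPT]; exact List.mem_append_right _ (mem_look1_of_sublist Pv MP T r b Ot HT1 hL he' hrv hx)
    | 1, _ :: _ :: _, _, hlen, _, _, _ => simp at hlen
    | 2, e', he', hlen, hrv, hx, step =>
      rw [scanPT]
      split
      · rename_i hpr
        match e', he', hlen, hrv, hx with
        | [], _, _, hrv, hx => exact List.mem_append_left _ (mem_leaf_of_nil Pv MP hrv hx)
        | [a], he', _, hrv, hx =>
          exact List.mem_append_right _ (List.mem_append_left _ (mem_look1_of_sublist Pv MP T r b Ot HT1 hL he' hrv hx))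
        | [a, c], he', _, hrv, hx =>
          exact List.mem_append_right _ (List.mem_append_right _
            (mem_look2_of_sublist Pv MP T r b Ot HT1 (hP hpr) hL he' hrv hx))
        | _ :: _ :: _ :: _, _, hlen, _, _ => simp at hlen
      · exact step 1 hlen
    | s' + 3, e', he', hlen, hrv, hx, step => simp only [scanPT]; exact step (s' + 2) hlen

end Look

end Summit.Ventures.QEC.Census.Fold
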